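import Literature.NumberTheory.EllipticCurves.BurungaleSkinnerTianWan2024.SupersingularTwistPPartOPEN
import Literature.NumberTheory.EllipticCurves.QuadraticTwistKroneckerLFunctionProofs
import Literature.NumberTheory.EllipticCurves.Rank1Residual.Dedup
import Literature.NumberTheory.EllipticCurves.SupersingularIrreducibleProofs
import Summits.BirchSwinnertonDyer.Rank1Residual.Supersingular.TwistStability
import HarnessLib

/-!
# X7, the BSTW-twist-shape sub-family: the announced twist clause of BSTW Thm. 1.5 as an OPEN binder
# with every automatic hypothesis DISCHARGED (`GoodSS`, `Irr`, `a_3 = 0`, not X8)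
# (cell `b2b-bsdres`, supersingular family, prover B = unit `b2b-bsdres-additive-p3`, gen 16;
# CLASS-CLOSURE lane §3.11, E2: the verbatim-extension sub-class of X7)

HONEST FRAMING (run/shared/lean/b2b/bsd-rank1-residual/, verbatim in every file): the goal of the
cell is to DELETE the COMBINATION-SHAPED residual classes of the Birch–Swinnerton-Dyer formula for
ALL analytic-rank `≤ 1` elliptic curves over `ℚ` — "full BSD formula for every rank `≤ 1` curve in
class `C`" assembled STRICTLY from published theorems — so that the rank-`≤ 1` remainder becomes
exactly the CONSTRUCTION-SHAPED classes, which are TYPED (missing-input `Prop`s), NOT attempted.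
This is not "finishing BSD". THEOREMS ONLY; the one OPEN binder taken (`hBSTW_OPEN :
BurungaleSkinnerTianWan2024.thm15_twist_pPart_OPEN`, the ANNOUNCED twist clause of BSTW
arXiv:2409.01350v2 Thm. 1.5 — PRE, never a theorem) is displayed; nothing about any particular curve
is asserted; X7 stays CONSTRUCTION-SHAPED; nothing is booked.

## What this file proves

For the twist datum of the clause — `W₀` globally minimal and SEMISTABLE, `p ≠ 2` good supersingular
for `W₀` (`a_3(W₀) = 0` if `p = 3`), `d ≠ 1` square-free with every prime ramified in `ℚ(√d)`
(`RamifiedInQuadratic d q`) different from `p` and good ORDINARY for `W₀`, `W` a globally minimal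
model of `W₀^{(d)}` (`C • W = W₀.quadraticTwist d`):

* `not_dvd_two_mul_of_twistClause` (Literature): `p ∤ 2d` — so the tree's twist lemmas apply;
* `goodSS_of_twistClause`: **`GoodSS W p`** — good supersingular reduction passes to the twist
  (`Supersingular/TwistStability.lean`, gen 16: good reduction at `p ∤ 2d` and `a_p(W) = (d/p)·a_p(W₀)`);
* `frobeniusTrace_of_twistClause`, `frobeniusTrace_three_eq_zero_of_twistClause`: `a_p(W) = ±a_p(W₀)`,
  and at `p = 3` the clause's (h4) gives `a_3(W) = 0` — so **the twist is never an X8 pair**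
  (`not_classX8_of_twistClause`);
* `irr_of_twistClause`: **`Irr W p`** (Serre 1972 §1.11 Prop. 12 at the odd supersingular prime of `W`,
  tree theorem `hasIrreducibleModPGaloisRep_of_dvd_frobeniusTrace`);
* **`bsdp_of_thm15_twist_OPEN'`**: granted the OPEN binder and GZK, `BSD(W, p)` at every such twist in
  analytic rank `≤ 1` — NO further hypothesis (the Literature version's `Irr W p` discharged).
* APPEND (same gen): `not_semistable_of_smul_eq_quadraticTwist_of_odd_prime_dvd` (an odd prime `q ∣ d`
  of good reduction of `W₀` makes the twist ADDITIVE at `q`, tree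
  `hasAdditiveReductionAt_quadraticTwist_of_dvd` + `isSemistableAt_smul_iff_holds`), hence
  **`classX7_of_twistClause`** (the twist IS an X7 pair whenever `d ∉ {−1, ±2}`) and
  `ClassX6.classX7_of_smul_eq_quadraticTwist` (X6 → X7 by twisting: X6 is not twist-stable).

READING (numbers of record, rmap-2 GEN 4 kit j112050; nothing booked): the datum describes the
"BSTW-twist-shape" X7 pairs — `W` is non-semistable as soon as `d ≠ 1` (additive, type `I₀*`, at the
odd ramified primes: tree `hasAdditiveReductionAt_quadraticTwist_of_dvd`; not re-proved here) —
64 (r = 0) ‖ 248 (r = 1) + 2 (tail) = 314 of the 7 210 X7/X7T S-b residue pairs (4.4 %); windows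
N < 10⁴ ‖ 2·10⁴: 1 ‖ 2 pairs (8190x1@311, 13426c1@3). On the day BSTW is refereed these close with
X6; the remaining 2 230 ‖ 4 623 + 43 X7 pairs are outside every announced statement (the ± IMC at
non-square-free level — CLASS-CLOSURE §3.11's irreducible residue).

References: [BurungaleSkinnerTianWan2024] Thm. 1.3 (twist clause), Thm. 1.5; [Serre1972] §1.11
Prop. 12; [Knapp1993] Prop. 12.10; [Miller2011LMS] §1, Def. 1.1.
-/

set_option autoImplicit false

noncomputable section

open scoped Classical

open WeierstrassCurve Literature.NumberTheory.EllipticCurves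
  Literature.NumberTheory.EllipticCurves.Rank1Residual
  Literature.NumberTheory.EllipticCurves.BurungaleSkinnerTianWan2024

namespace Summit.BirchSwinnertonDyer.Rank1Residual.Supersingular

section TwistClause

variable (W₀ W : WeierstrassCurve ℚ) [W₀.IsElliptic] [W₀.IsGloballyMinimal] [W.IsElliptic]
  [W.IsGloballyMinimal] (p : ℕ) [hp : Fact p.Prime]

omit [W.IsElliptic] in
/-- **The twist of the clause is good supersingular at `p`**: `GoodSS W p` for a globally minimal
model `W` of `W₀^{(d)}` under the clause's hypotheses (`p ∤ 2d` by `not_dvd_two_mul_of_twistClause`;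
then `goodSS_of_smul_eq_quadraticTwist`). [cite: Knapp1993, Prop. 12.10] [cite: SilvermanAEC2009, VII.5 Prop. 5.1(a)] -/
theorem goodSS_of_twistClause (hp2 : p ≠ 2) (hss : GoodSS W₀ p) {d : ℤ} (hd : Squarefree d)
    (hram : ∀ (q : ℕ) [Fact q.Prime], RamifiedInQuadratic d q → q ≠ p ∧ GoodOrd W₀ q)
    {C : VariableChange ℚ} (hC : C • W = W₀.quadraticTwist (d : ℚ)) : GoodSS W p :=
  goodSS_of_smul_eq_quadraticTwist W₀ W p hss hd hC (not_dvd_two_mul_of_twistClause hp2 hss hram)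

omit [W.IsElliptic] in
/-- `a_p(W) = (d/p)·a_p(W₀)` for the twist of the clause. [cite: Knapp1993, Prop. 12.10] -/
theorem frobeniusTrace_of_twistClause (hp2 : p ≠ 2) (hss : GoodSS W₀ p) {d : ℤ} (hd : Squarefree d)
    (hram : ∀ (q : ℕ) [Fact q.Prime], RamifiedInQuadratic d q → q ≠ p ∧ GoodOrd W₀ q)
    {C : VariableChange ℚ} (hC : C • W = W₀.quadraticTwist (d : ℚ)) :
    W.frobeniusTrace p = legendreSym p d * W₀.frobeniusTrace p :=
  frobeniusTrace_of_smul_eq_quadraticTwist W₀ W p hd hC (not_dvd_two_mul_of_twistClause hp2 hss hram)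
    hss.1

omit [W.IsElliptic] in
/-- **At `p = 3` the twist has `a_3 = 0`** ((h4) for `W₀` and `a_3(W) = ±a_3(W₀)`): the BSTW-twist
sub-family never meets class X8. [cite: BurungaleSkinnerTianWan2024, §1.2.1 (h4) and Thm. 1.3 (twist clause; shape only)] -/
theorem frobeniusTrace_three_eq_zero_of_twistClause (hp3 : p = 3) (hss : GoodSS W₀ p)
    (h4 : p = 3 → W₀.frobeniusTrace 3 = 0) {d : ℤ} (hd : Squarefree d)
    (hram : ∀ (q : ℕ) [Fact q.Prime], RamifiedInQuadratic d q → q ≠ p ∧ GoodOrd W₀ q)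
    {C : VariableChange ℚ} (hC : C • W = W₀.quadraticTwist (d : ℚ)) : W.frobeniusTrace 3 = 0 := by
  subst hp3
  rw [frobeniusTrace_of_twistClause W₀ W 3 (by decide) hss hd hram hC, h4 rfl, mul_zero]

omit [W.IsElliptic] in
/-- **The twist of the clause is not an X8 pair** (at `p = 3` its `a_3` vanishes).
[cite: BurungaleSkinnerTianWan2024, §1.2.1 (h4) and Thm. 1.3 (twist clause; shape only)] -/
theorem not_classX8_of_twistClause (hss : GoodSS W₀ p)
    (h4 : p = 3 → W₀.frobeniusTrace 3 = 0) {d : ℤ} (hd : Squarefree d)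
    (hram : ∀ (q : ℕ) [Fact q.Prime], RamifiedInQuadratic d q → q ≠ p ∧ GoodOrd W₀ q)
    {C : VariableChange ℚ} (hC : C • W = W₀.quadraticTwist (d : ℚ)) : ¬ ClassX8 W p := by
  rintro ⟨hp3, -, hne⟩
  exact hne (frobeniusTrace_three_eq_zero_of_twistClause W₀ W p hp3 hss h4 hd hram hC)

/-- **`E[p]` is irreducible for the twist** (Serre 1972 §1.11 Prop. 12 at the odd good supersingular
prime `p` of `W`). [cite: Serre1972, §1.11 Prop. 12] -/
theorem irr_of_twistClause (hp2 : p ≠ 2) (hss : GoodSS W₀ p) {d : ℤ} (hd : Squarefree d)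
    (hram : ∀ (q : ℕ) [Fact q.Prime], RamifiedInQuadratic d q → q ≠ p ∧ GoodOrd W₀ q)
    {C : VariableChange ℚ} (hC : C • W = W₀.quadraticTwist (d : ℚ)) : Irr W p := by
  have hG := goodSS_of_twistClause W₀ W p hp2 hss hd hram hC
  exact hasIrreducibleModPGaloisRep_of_dvd_frobeniusTrace W p hp2
    (W.not_dvd_minimalDiscriminantInt_of_hasGoodReductionAtPrime' p hG.1) hG.2

/-- **The BSTW-twist-shape sub-family of X7: conditional `BSD(E^K, p)` with NO automatic binder
left.** IF the announced twist clause of BSTW Thm. 1.5 (`hBSTW_OPEN`, unrefereed) holds, then for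
the twist datum of the clause (`W₀` semistable, `p ≠ 2` good supersingular for `W₀`, (h4) at `p = 3`,
`d ≠ 1` square-free with all ramified primes `≠ p` and good ordinary for `W₀`, `W` a globally
minimal model of `W₀^{(d)}`) and `r_an(W) ≤ 1`: Miller's `BSD(W, p)` (GZK `hGZK`; `Irr W p` by
`irr_of_twistClause`). CONDITIONAL on a PREPRINT; closes nothing; X7 stays CONSTRUCTION-SHAPED.
[cite: BurungaleSkinnerTianWan2024, Thm. 1.5 with Thm. 1.3 (twist clause; ANNOUNCED, OPEN binder)] [cite: Serre1972, §1.11 Prop. 12] [cite: Miller2011LMS, §1 and Def. 1.1] -/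
theorem bsdp_of_thm15_twist_OPEN' (hBSTW_OPEN : thm15_twist_pPart_OPEN)
    (hGZK : rank_eq_analyticRank_of_analyticRank_le_one) (hp2 : p ≠ 2) (hsst : Semistable W₀)
    (hss : GoodSS W₀ p) (h4 : p = 3 → W₀.frobeniusTrace 3 = 0) {d : ℤ} (hd : Squarefree d)
    (hd1 : d ≠ 1) (hram : ∀ (q : ℕ) [Fact q.Prime], RamifiedInQuadratic d q → q ≠ p ∧ GoodOrd W₀ q)
    {C : VariableChange ℚ} (hC : C • W = W₀.quadraticTwist (d : ℚ)) (hr : W.analyticRank ≤ 1) :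
    BSDp W p :=
  bsdp_of_thm15_twist_OPEN hBSTW_OPEN hGZK W₀ W p hp2 hsst hss h4 hd hd1 hram hC
    (irr_of_twistClause W₀ W p hp2 hss hd hram hC) hr

/-- The same with the conclusion phrased on the supersingular axis: the pair `(W, p)` is a `GoodSS`
pair, not X8, with `BSD(W,p)` granted the OPEN binder — i.e. it is an X6-or-X7 pair covered by the
announcement (X7 as soon as `W` is non-semistable, which holds whenever `d ≠ 1`: additive type
`I₀*` at the odd ramified primes). [cite: BurungaleSkinnerTianWan2024, Thm. 1.5 with Thm. 1.3 (twist clause; ANNOUNCED, OPEN binder)] -/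
theorem goodSS_and_not_classX8_and_bsdp_of_thm15_twist_OPEN (hBSTW_OPEN : thm15_twist_pPart_OPEN)
    (hGZK : rank_eq_analyticRank_of_analyticRank_le_one) (hp2 : p ≠ 2) (hsst : Semistable W₀)
    (hss : GoodSS W₀ p) (h4 : p = 3 → W₀.frobeniusTrace 3 = 0) {d : ℤ} (hd : Squarefree d)
    (hd1 : d ≠ 1) (hram : ∀ (q : ℕ) [Fact q.Prime], RamifiedInQuadratic d q → q ≠ p ∧ GoodOrd W₀ q)
    {C : VariableChange ℚ} (hC : C • W = W₀.quadraticTwist (d : ℚ)) (hr : W.analyticRank ≤ 1) :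
    GoodSS W p ∧ ¬ ClassX8 W p ∧ BSDp W p :=
  ⟨goodSS_of_twistClause W₀ W p hp2 hss hd hram hC,
    not_classX8_of_twistClause W₀ W p hss h4 hd hram hC,
    bsdp_of_thm15_twist_OPEN' W₀ W p hBSTW_OPEN hGZK hp2 hsst hss h4 hd hd1 hram hC hr⟩

end TwistClause


/-! ### APPEND (gen 16): the twist of the clause IS an X7 pair as soon as `d` has an odd prime factor -/

section Membership

open IsDedekindDomain NumberField Rat.HeightOneSpectrum

variable (W₀ W : WeierstrassCurve ℚ) [W₀.IsElliptic] [W₀.IsGloballyMinimal] [W.IsElliptic]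
  [W.IsGloballyMinimal] (p : ℕ) [hp : Fact p.Prime]

omit [W.IsGloballyMinimal] hp p in
/-- **The twist is NOT semistable**: if an ODD prime `q` divides the square-free `d` and `W₀` has
good reduction at `q`, then any `W` with `C • W = W₀^{(d)}` has ADDITIVE reduction at `q` (type
`I₀*`; tree `hasAdditiveReductionAt_quadraticTwist_of_dvd`, transported along `C` by
`isSemistableAt_smul_iff_holds`), so `¬ Semistable W`. [cite: SilvermanAEC2009, VII.1 Remark 1.1 and VII.5 Prop. 5.1(c)] -/
theorem not_semistable_of_smul_eq_quadraticTwist_of_odd_prime_dvd {d : ℤ} (hd : Squarefree d)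
    {C : VariableChange ℚ} (hC : C • W = W₀.quadraticTwist (d : ℚ)) {q : ℕ} [hq : Fact q.Prime]
    (hq2 : q ≠ 2) (hqd : (q : ℤ) ∣ d) (hgood : W₀.HasGoodReductionAtPrime q) : ¬ Semistable W := by
  have hqP : q.Prime := hq.out
  obtain ⟨v, rfl⟩ : ∃ v : HeightOneSpectrum (𝓞 ℚ), (primesEquiv v : ℕ) = q :=
    ⟨primesEquiv.symm ⟨q, hqP⟩, by rw [Equiv.apply_symm_apply]⟩
  have hd0 : d ≠ 0 := hd.ne_zero
  have hsq : ¬ ((primesEquiv v : ℕ) : ℤ) ^ 2 ∣ d := by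
    intro h
    have h1 : ((primesEquiv v : ℕ) : ℤ) * (primesEquiv v : ℕ) ∣ d := by rwa [← sq]
    have hu := hd _ h1
    rw [Int.isUnit_iff_natAbs_eq, Int.natAbs_natCast] at hu
    exact hqP.ne_one hu
  have hgoodv : W₀.HasGoodReductionAt v :=
    (hasGoodReductionAtPrime_iff_hasGoodReductionAt_ringOfIntegers v W₀).mp hgood
  have hadd : (W₀.quadraticTwist (d : ℚ)).HasAdditiveReductionAt v :=
    hasAdditiveReductionAt_quadraticTwist_of_dvd W₀ v hq2 hd0 hqd hsq hgoodv
  have hdQ : ((d : ℤ) : ℚ) ≠ 0 := by exact_mod_cast hd0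
  haveI := W₀.isElliptic_quadraticTwist hdQ
  have hnot : ¬ (W₀.quadraticTwist (d : ℚ)).IsSemistableAt v := by
    rw [isSemistableAt_iff_not_hasAdditiveReductionAt, not_not]
    exact hadd
  have hnotW : ¬ W.IsSemistableAt v := by
    rw [← hC] at hnot
    rwa [isSemistableAt_smul_iff_holds v W C] at hnot
  intro hsst
  exact hnotW ((semistable_iff_isSemistable_ringOfIntegers W).mp hsst v)

omit [W.IsElliptic] in
/-- **The twist of the clause is an X7 pair** whenever `d` has an odd prime factor `q` (every
square-free `d ∉ {−1, 2, −2}`): `GoodSS W p` (`goodSS_of_twistClause`) and `¬ Semistable W`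
(additive at `q`, where `W₀` is good by the clause). [cite: BurungaleSkinnerTianWan2024, Thm. 1.3 (twist clause; shape only)]
[cite: SilvermanAEC2009, VII.5 Prop. 5.1(c)] -/
theorem classX7_of_twistClause [W.IsElliptic] (hp2 : p ≠ 2) (hss : GoodSS W₀ p) {d : ℤ}
    (hd : Squarefree d)
    (hram : ∀ (q : ℕ) [Fact q.Prime], RamifiedInQuadratic d q → q ≠ p ∧ GoodOrd W₀ q)
    {C : VariableChange ℚ} (hC : C • W = W₀.quadraticTwist (d : ℚ)) {q : ℕ} [Fact q.Prime]
    (hq2 : q ≠ 2) (hqd : (q : ℤ) ∣ d) : ClassX7 W p :=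
  ⟨goodSS_of_twistClause W₀ W p hp2 hss hd hram hC,
    not_semistable_of_smul_eq_quadraticTwist_of_odd_prime_dvd W₀ W hd hC hq2 hqd
      (hram q (Or.inl hqd)).2.1⟩

omit [W.IsElliptic] in
/-- **X6 → X7 by twisting**: for `W₀ ∈ X6` (semistable, good supersingular at the odd `p`), a
square-free `d` with `p ∤ 2d` having an odd prime factor `q` at which `W₀` is good, and `W` a
globally minimal model of `W₀^{(d)}`: `W ∈ X7` (`GoodSS` passes to the twist; `W` is additive at
`q`). So X6 is NOT twist-stable, and the twist relation runs between X6 and the twist-shape part of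
X7 in both directions (`exists_smul_eq_quadraticTwist_symm`). [cite: SilvermanAEC2009, VII.5 Prop. 5.1(c)] [cite: Knapp1993, Prop. 12.10] -/
theorem ClassX6.classX7_of_smul_eq_quadraticTwist [W.IsElliptic] (hX : ClassX6 W₀ p) {d : ℤ}
    (hd : Squarefree d) {C : VariableChange ℚ} (hC : C • W = W₀.quadraticTwist (d : ℚ))
    (hp2d : ¬ (p : ℤ) ∣ 2 * d) {q : ℕ} [Fact q.Prime] (hq2 : q ≠ 2) (hqd : (q : ℤ) ∣ d)
    (hgood : W₀.HasGoodReductionAtPrime q) : ClassX7 W p :=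
  ⟨goodSS_of_smul_eq_quadraticTwist W₀ W p hX.1 hd hC hp2d,
    not_semistable_of_smul_eq_quadraticTwist_of_odd_prime_dvd W₀ W hd hC hq2 hqd hgood⟩

end Membership

end Summit.BirchSwinnertonDyer.Rank1Residual.Supersingular

end
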